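import Mathlib
import HarnessLib
import Summits.ResolutionOfSingularities.ResolutionOfSingularities.Theses.CleanCovers
import Literature.AlgebraicGeometry.Resolution.LogRegularSchemeEtale
import Literature.AlgebraicGeometry.Resolution.ComponentGluing
import Literature.AlgebraicGeometry.Resolution.PrincipalizationToResolution

/-!
# Birth skeleton (BC3) of the child `BoundaryLogRegularization` of `CleanCovers.CoverResolution`

Line `base-only-cleaning` (the route's engine, read LOCALLY on the base): normalise the cover
(`stub_normalCover`: a Kedlaya cover receives a finite birational morphism from a NORMAL Kedlaya
cover — the normalisation, finite by E. Noether / Liu 4.1.27, étale over the chart because the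
cover is regular there), then, for a normal cover, blow up the BASE near a boundary point until the
normalised pullback is log regular (`stub_baseOnlyLocalModel`: near every `h ∈ H` there is a proper
birational REGULAR base modification `W → B` and a scheme `Y` FINITE over `W`, log regular for fs
étale charts, proper birational over `f⁻¹(B)` — the typed output of "clean + (NpS) after base
blow-ups ⇒ log-regular normalisation", AbbesSaito2011 Prop. 2.22, Kato1994Ramification Thm 4.1,
the informal items CleanSolvableModel/CleanCoverLogRegular). `boundaryLogRegularization_of`
composes: the model over the normal cover descends along the finite birational `ν`.
The conclusion is the child's statement VERBATIM (local mirror `BoundaryLogRegularization`; after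
the split it is `Theses.CleanCovers.BoundaryLogRegularization` by `Iff.rfl`).
-/

set_option linter.dupNamespace false

namespace Summit.ResolutionOfSingularities.ResolutionOfSingularities.Cruxes.BoundaryLogRegularization.Birth

open CategoryTheory AlgebraicGeometry TopologicalSpace
open Literature.AlgebraicGeometry.Resolution

/-- VERBATIM mirror of the child statement `CleanCovers.BoundaryLogRegularization` (not yet a
route decl: the split is pending). -/
def BoundaryLogRegularization : Prop :=
  ∀ p : ℕ, p.Prime → ∀ (k : Type) [Field k] [CharP k p] [PerfectField k] (n : ℕ) (X : AlgebraicGeometry.Scheme.{0}) (f : X ⟶ (Literature.AlgebraicGeometry.Motives.projectiveSpace n k).left), AlgebraicGeometry.IsIntegral X → AlgebraicGeometry.IsFinite f → Function.Surjective f.base → (letI := MvPolynomial.gradedAlgebra (σ := Fin (n + 1)) (R := k); AlgebraicGeometry.Etale (f ∣_ (AlgebraicGeometry.Proj.basicOpen (MvPolynomial.homogeneousSubmodule (Fin (n + 1)) k) (MvPolynomial.X (Fin.last n))))) → ∀ h : (Literature.AlgebraicGeometry.Motives.projectiveSpace n k).left, (letI := MvPolynomial.gradedAlgebra (σ := Fin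 (n + 1)) (R := k); h ∉ AlgebraicGeometry.Proj.basicOpen (MvPolynomial.homogeneousSubmodule (Fin (n + 1)) k) (MvPolynomial.X (Fin.last n))) → ∃ B : (Literature.AlgebraicGeometry.Motives.projectiveSpace n k).left.Opens, h ∈ B ∧ ∃ (Y : AlgebraicGeometry.Scheme.{0}) (π : Y ⟶ ((f ⁻¹ᵁ B : X.Opens) : AlgebraicGeometry.Scheme.{0})), AlgebraicGeometry.IsProper π ∧ Literature.AlgebraicGeometry.Resolution.IsBirational π ∧ Literature.AlgebraicGeometry.Resolution.Scheme.IsLogRegularEtale Y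

/-- STUB A (normalisation): every Kedlaya cover `f : X → ℙⁿ_k` receives a finite birational
morphism `ν : X' → X` from an integral scheme with integrally closed local rings such that
`ν ≫ f` is again a Kedlaya cover (surjective, étale over the chart). Intended witness: the
normalisation `X^ν` (tree `normalization X`; finiteness: `isFinite_normalizationι` modulo the named
fact `NoetherFiniteIntegralClosure`; `ν` is an isomorphism over the regular open `f⁻¹(D₊(xₙ))`). -/
theorem stub_normalCover : ∀ p : ℕ, p.Prime → ∀ (k : Type) [Field k] [CharP k p] [PerfectField k] (n : ℕ) (X : AlgebraicGeometry.Scheme.{0}) (f : X ⟶ (Literature.AlgebraicGeometry.Motives.projectiveSpace n k).left), AlgebraicGeometry.IsIntegral X → AlgebraicGeometry.IsFinite f → Function.Surjective f.base → (letI := MvPolynomial.gradedAlgebra (σ := Fin (n + 1)) (R := k); AlgebraicGeometry.Etale (f ∣_ (AlgebraicGeometry.Proj.basicOpen (MvPolynomial.homogeneousSubmodule (Fin (n + 1)) k) (MvPolynomial.X (Fin.last n))))) → ∃ (X' : AlgebraicGeometry.Scheme.{0}) (ν : X' ⟶ X), AlgebraicGeometry.IsIntegral X' ∧ AlgebraicGeometry.IsFinite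 ν ∧ Literature.AlgebraicGeometry.Resolution.IsBirational ν ∧ Function.Surjective (ν ≫ f).base ∧ (letI := MvPolynomial.gradedAlgebra (σ := Fin (n + 1)) (R := k); AlgebraicGeometry.Etale ((ν ≫ f) ∣_ (AlgebraicGeometry.Proj.basicOpen (MvPolynomial.homogeneousSubmodule (Fin (n + 1)) k) (MvPolynomial.X (Fin.last n))))) ∧ ∀ x' : X', IsIntegrallyClosed (X'.presheaf.stalk x') := by
  sorry

/-- STUB B (base-only local log-regularization of a NORMAL Kedlaya cover): near every boundary
point `h` there are an open `B ∋ h`, a proper birational REGULAR modification `β : W → B` of the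
base, and a scheme `Y` finite over `W`, log regular (fs étale charts), with a proper birational
`π : Y → f⁻¹(B)` over `β` (`π ≫ f|_B = g ≫ β`). The cleaning engine: `W` = a local clean & (NpS)
model of the base, `Y` = the normalisation of `W` in `K(X)`. -/
theorem stub_baseOnlyLocalModel : ∀ p : ℕ, p.Prime → ∀ (k : Type) [Field k] [CharP k p] [PerfectField k] (n : ℕ) (X : AlgebraicGeometry.Scheme.{0}) (f : X ⟶ (Literature.AlgebraicGeometry.Motives.projectiveSpace n k).left), AlgebraicGeometry.IsIntegral X → AlgebraicGeometry.IsFinite f → Function.Surjective f.base → (letI := MvPolynomial.gradedAlgebra (σ := Fin (n + 1)) (R := k); AlgebraicGeometry.Etale (f ∣_ (AlgebraicGeometry.Proj.basicOpen (MvPolynomial.homogeneousSubmodule (Fin (n + 1)) k) (MvPolynomial.X (Fin.last n))))) → (∀ x : X, IsIntegrallyClosed (X.presheaf.stalk x)) → ∀ h : (Literature.AlgebraicGeometry.Motives.projectiveSpace n k).left, (letI := MvPolynomial.gradedAlgebra (σ := Fin (n + 1)) (R := k); h ∉ AlgebraicGeometry.Proj.basicOpen (MvPolynomial.homogeneousSubmodule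 (Fin (n + 1)) k) (MvPolynomial.X (Fin.last n))) → ∃ B : (Literature.AlgebraicGeometry.Motives.projectiveSpace n k).left.Opens, h ∈ B ∧ ∃ (W : AlgebraicGeometry.Scheme.{0}) (β : W ⟶ ((B : (Literature.AlgebraicGeometry.Motives.projectiveSpace n k).left.Opens) : AlgebraicGeometry.Scheme.{0})), AlgebraicGeometry.IsProper β ∧ Literature.AlgebraicGeometry.Resolution.IsBirational β ∧ Literature.AlgebraicGeometry.Resolution.Scheme.IsRegular W ∧ ∃ (Y : AlgebraicGeometry.Scheme.{0}) (g : Y ⟶ W) (π : Y ⟶ ((f ⁻¹ᵁ B : X.Opens) : AlgebraicGeometry.Scheme.{0})), AlgebraicGeometry.IsFinite g ∧ π ≫ (f ∣_ B) = g ≫ β ∧ AlgebraicGeometry.IsProper π ∧ Literature.AlgebraicGeometry.Resolution.IsBirational π ∧ Literature.AlgebraicGeometry.Resolution.Scheme.IsLogRegularEtale Y := by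
  sorry

/-- `BoundaryLogRegularization` from the two stubs: normalise, take the base-only local model of
the normal cover, and descend it along the finite (hence proper) birational `ν` restricted over
`f⁻¹(B)`. [folklore] -/
theorem boundaryLogRegularization_of :
    (∀ p : ℕ, p.Prime → ∀ (k : Type) [Field k] [CharP k p] [PerfectField k] (n : ℕ) (X : AlgebraicGeometry.Scheme.{0}) (f : X ⟶ (Literature.AlgebraicGeometry.Motives.projectiveSpace n k).left), AlgebraicGeometry.IsIntegral X → AlgebraicGeometry.IsFinite f → Function.Surjective f.base → (letI := MvPolynomial.gradedAlgebra (σ := Fin (n + 1)) (R := k); AlgebraicGeometry.Etale (f ∣_ (AlgebraicGeometry.Proj.basicOpen (MvPolynomial.homogeneousSubmodule (Fin (n + 1)) k) (MvPolynomial.X (Fin.last n))))) → ∃ (X' : AlgebraicGeometry.Scheme.{0}) (ν : X' ⟶ X), AlgebraicGeometry.IsIntegral X' ∧ AlgebraicGeometry.IsFinite ν ∧ Literature.AlgebraicGeometry.Resolution.IsBirational ν ∧ Function.Surjective (ν ≫ f).base ∧ (letI := MvPolynomial.gradedAlgebra (σ := Fin (n + 1)) (R := k); AlgebraicGeometry.Etale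 ((ν ≫ f) ∣_ (AlgebraicGeometry.Proj.basicOpen (MvPolynomial.homogeneousSubmodule (Fin (n + 1)) k) (MvPolynomial.X (Fin.last n))))) ∧ ∀ x' : X', IsIntegrallyClosed (X'.presheaf.stalk x')) →
    (∀ p : ℕ, p.Prime → ∀ (k : Type) [Field k] [CharP k p] [PerfectField k] (n : ℕ) (X : AlgebraicGeometry.Scheme.{0}) (f : X ⟶ (Literature.AlgebraicGeometry.Motives.projectiveSpace n k).left), AlgebraicGeometry.IsIntegral X → AlgebraicGeometry.IsFinite f → Function.Surjective f.base → (letI := MvPolynomial.gradedAlgebra (σ := Fin (n + 1)) (R := k); AlgebraicGeometry.Etale (f ∣_ (AlgebraicGeometry.Proj.basicOpen (MvPolynomial.homogeneousSubmodule (Fin (n + 1)) k) (MvPolynomial.X (Fin.last n))))) → (∀ x : X, IsIntegrallyClosed (X.presheaf.stalk x)) → ∀ h : (Literature.AlgebraicGeometry.Motives.projectiveSpace n k).left, (letI := MvPolynomial.gradedAlgebra (σ := Fin (n + 1)) (R := k); h ∉ AlgebraicGeometry.Proj.basicOpen (MvPolynomial.homogeneousSubmodule (Fin (n + 1)) k)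 (MvPolynomial.X (Fin.last n))) → ∃ B : (Literature.AlgebraicGeometry.Motives.projectiveSpace n k).left.Opens, h ∈ B ∧ ∃ (W : AlgebraicGeometry.Scheme.{0}) (β : W ⟶ ((B : (Literature.AlgebraicGeometry.Motives.projectiveSpace n k).left.Opens) : AlgebraicGeometry.Scheme.{0})), AlgebraicGeometry.IsProper β ∧ Literature.AlgebraicGeometry.Resolution.IsBirational β ∧ Literature.AlgebraicGeometry.Resolution.Scheme.IsRegular W ∧ ∃ (Y : AlgebraicGeometry.Scheme.{0}) (g : Y ⟶ W) (π : Y ⟶ ((f ⁻¹ᵁ B : X.Opens) : AlgebraicGeometry.Scheme.{0})), AlgebraicGeometry.IsFinite g ∧ π ≫ (f ∣_ B) = g ≫ β ∧ AlgebraicGeometry.IsProper π ∧ Literature.AlgebraicGeometry.Resolution.IsBirational π ∧ Literature.AlgebraicGeometry.Resolution.Scheme.IsLogRegularEtale Y) →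
    BoundaryLogRegularization := by
  intro hA hB p hp k _ _ _ n X f hint hfin hsurj het h hh
  letI := MvPolynomial.gradedAlgebra (σ := Fin (n + 1)) (R := k)
  haveI := hfin
  obtain ⟨X', ν, hint', hfinν, hbirν, hsurj', het', hnorm⟩ := hA p hp k n X f hint hfin hsurj het
  haveI := hint'
  haveI := hfinν
  haveI : IsFinite (ν ≫ f) := inferInstance
  obtain ⟨B, hhB, W, β, -, -, -, Y, g, π, -, -, hπ, hbirπ, hY⟩ :=
    hB p hp k n X' (ν ≫ f) hint' inferInstance hsurj' het' hnorm h hh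
  refine ⟨B, hhB, Y, π ≫ (ν ∣_ (f ⁻¹ᵁ B)), ?_, ?_, hY⟩
  · haveI : IsProper ν := inferInstance
    have hν' : IsProper (ν ∣_ (f ⁻¹ᵁ B)) := inferInstance
    exact MorphismProperty.comp_mem @IsProper _ _ hπ hν'
  · exact IsBirational.comp hbirπ (hbirν.morphismRestrict (f ⁻¹ᵁ B))

end Summit.ResolutionOfSingularities.ResolutionOfSingularities.Cruxes.BoundaryLogRegularization.Birth
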